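import Mathlib

/-!
# Solo-blind seat, s16 anchor: the descent lemma for arbitrary submanifold triples (Theorem 10) — arithmetic core

Companion to `paper/LieExponent.md` §3.23 (solo-blind seat `solo-MatrixMultiplication-blind`, s16).

THEOREM 10 there (pen-proof, elementary given §3.20–3.21): for a TPP triple of connected `C^∞`
submanifolds of a real Lie group `G` with `Σ = Σ dim M_i > d = dim G`, the level sets of the three
partial annihilator maps at a generic base point are integral manifolds of ONE Pfaffian equation
`α_λ = 0`, of dimensions `≥ d_i − (m_i − 1)`, they form a TPP sub-triple, and their slices along the
Cauchy-characteristic subgroup `A_λ` (dimension `a`) form a TPP triple in `A_λ` whose deficit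
`δ_A := 3a/2 − Σ dim S_i` satisfies the DESCENT INEQUALITY
`δ_A ≤ δ − 3/2 + R ≤ 3δ − 9/2`, where `δ := 3d/2 − Σ` and `R ≤ 2δ − 3` is the annihilator motion.
Iterating down the characteristic tower (levels `ℓ < t`, bottom estimate `δ_t ≥ a_t/2`,
`a_t ≥ ind 𝔤 − 2t + 1`) gives the MOTION–DEFICIT INEQUALITY `δ + Σ_{ℓ<t} R_ℓ ≥ (ind 𝔤 + t + 1)/2`,
Theorem E for all triples (regular annihilator ⟹ `Σ ≤ 3d/2 − ind 𝔤/6 − 4/3`), singularity forcing,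
and — for hereditarily motionless triples such as subgroup triples — `Σ ≤ (3d − ind 𝔤)/2 − 1`, whence
`F(GL_n(ℝ)) = 3N + n − 1` exactly and the subgroup Lie exponent of `GL_n(ℝ)` is `3n/(n−1)`.

Kernel-checked here (the geometric inputs enter as hypotheses; what is certified is the bookkeeping
that turns the one-level inequality into the tower statements):
* `soloLie_descent_depth` — `δ_{ℓ+1} ≤ 3δ_ℓ − 9/2 (ℓ < t)` ⟹ `δ_t − 9/4 ≤ 3^t (δ_0 − 9/4)` ((E2′)).
* `soloLie_motion_deficit`, `soloLie_motion_deficit_index` — the telescoped motion–deficit inequality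
  and its index form `(ι + t + 1)/2 ≤ δ_0 + Σ_{ℓ<t} R_ℓ`.
* `soloLie_motion_breeding` — motion can breed at most geometrically:
  `Σ_{ℓ<t} R_ℓ ≤ (3^t − 1)(δ_0 − 9/4) + 3t/2` under `R_ℓ ≤ 2δ_ℓ − 3`.
* `soloLie_E1_arith`, `soloLie_singularity_forcing` — the abelian-slicing arithmetic behind (E1′)
  and the singularity-forcing bound `δ ≥ ι/6 − (z − ι)/2 − 1/3`.
* `soloLie_motionless_bound` — `R_ℓ = 0` at every level ⟹ `(ι + t + 1)/2 ≤ δ_0` (Theorem 5♯).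
* `soloLie_thm1_value`, `soloLie_subgroup_exponent_GL` — `(3n² − n)/2 − 1 = 3N + n − 1` and the
  certified exponent `n / (Σ/3 − (n² − n)/2) = 3n/(n−1)` at that value.
-/

set_option linter.dupNamespace false

namespace Summit.MatrixMultiplication.MatrixMultiplication.Theorems

open Finset

/-- (E2′) DEPTH FORM OF THE DESCENT.  If the deficits down the characteristic tower satisfy
`δ (ℓ+1) ≤ 3 δ ℓ − 9/2` for `ℓ < t`, then `δ t − 9/4 ≤ 3^t (δ 0 − 9/4)`; read upward,
`δ 0 ≥ 9/4 + 3^{-t} (δ t − 9/4)`. -/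
theorem soloLie_descent_depth (δ : ℕ → ℝ) (t : ℕ)
    (h : ∀ ℓ, ℓ < t → δ (ℓ + 1) ≤ 3 * δ ℓ - 9 / 2) :
    δ t - 9 / 4 ≤ 3 ^ t * (δ 0 - 9 / 4) := by
  induction t with
  | zero => simp
  | succ n ih =>
    have ih' := ih (fun ℓ hℓ => h ℓ (Nat.lt_succ_of_lt hℓ))
    have hn := h n (Nat.lt_succ_self n)
    have h3 : 3 * (δ n - 9 / 4) ≤ 3 * (3 ^ n * (δ 0 - 9 / 4)) :=
      mul_le_mul_of_nonneg_left ih' (by norm_num)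
    calc δ (n + 1) - 9 / 4 ≤ 3 * (δ n - 9 / 4) := by linarith
      _ ≤ 3 * (3 ^ n * (δ 0 - 9 / 4)) := h3
      _ = 3 ^ (n + 1) * (δ 0 - 9 / 4) := by ring

/-- MOTION–DEFICIT INEQUALITY, telescoped form.  One level of descent costs `−3/2` (Cauchy
characteristic gain) plus the annihilator motion `R ℓ`: `δ (ℓ+1) ≤ δ ℓ − 3/2 + R ℓ`.  Hence
`δ t ≤ δ 0 − 3t/2 + Σ_{ℓ<t} R ℓ`. -/
theorem soloLie_motion_deficit (δ R : ℕ → ℝ) (t : ℕ)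
    (h : ∀ ℓ, ℓ < t → δ (ℓ + 1) ≤ δ ℓ - 3 / 2 + R ℓ) :
    δ t ≤ δ 0 - 3 / 2 * t + ∑ ℓ ∈ range t, R ℓ := by
  induction t with
  | zero => simp
  | succ n ih =>
    have ih' := ih (fun ℓ hℓ => h ℓ (Nat.lt_succ_of_lt hℓ))
    have hn := h n (Nat.lt_succ_self n)
    rw [sum_range_succ]
    push_cast
    linarith

/-- MOTION–DEFICIT INEQUALITY, index form (Theorem 10 (MD)).  With the bottom estimate
`a/2 ≤ δ t` (no annihilator at level `t`: `Σ_t ≤ a_t`) and `a ≥ ι − 2t + 1`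
(`a_{ℓ+1} ≥ ind 𝔞_ℓ − 1`, `ind 𝔞_{ℓ+1} ≥ ind 𝔞_ℓ − 2`):
`(ι + t + 1)/2 ≤ δ 0 + Σ_{ℓ<t} R ℓ` — deficit below the Kirillov threshold is paid one-for-one by
annihilator motion down the tower. -/
theorem soloLie_motion_deficit_index (δ R : ℕ → ℝ) (t : ℕ) (ι a : ℝ)
    (h : ∀ ℓ, ℓ < t → δ (ℓ + 1) ≤ δ ℓ - 3 / 2 + R ℓ)
    (hbot : a / 2 ≤ δ t) (ha : ι - 2 * t + 1 ≤ a) :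
    (ι + t + 1) / 2 ≤ δ 0 + ∑ ℓ ∈ range t, R ℓ := by
  have := soloLie_motion_deficit δ R t h
  linarith

/-- THEOREM 5♯ (hereditarily motionless triples, e.g. three connected Lie subgroups): if `R ℓ = 0`
at every level then `(ι + t + 1)/2 ≤ δ 0`, i.e. `Σ ≤ (3d − ι − t − 1)/2 ≤ (3d − ι)/2 − 1` for
`t ≥ 1`. -/
theorem soloLie_motionless_bound (δ R : ℕ → ℝ) (t : ℕ) (ι a : ℝ)
    (h : ∀ ℓ, ℓ < t → δ (ℓ + 1) ≤ δ ℓ - 3 / 2 + R ℓ)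
    (hR : ∀ ℓ, ℓ < t → R ℓ = 0)
    (hbot : a / 2 ≤ δ t) (ha : ι - 2 * t + 1 ≤ a) :
    (ι + t + 1) / 2 ≤ δ 0 := by
  have hmd := soloLie_motion_deficit_index δ R t ι a h hbot ha
  have hsum : ∑ ℓ ∈ range t, R ℓ = 0 :=
    sum_eq_zero (fun ℓ hℓ => hR ℓ (mem_range.mp hℓ))
  linarith

/-- MOTION BREEDS AT MOST GEOMETRICALLY.  Under the one-level inequality and the slack bound
`R ℓ ≤ 2 δ ℓ − 3` (motion is bounded by the total pair slack at its own level), the total motion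
down `t` levels is at most `(3^t − 1)(δ 0 − 9/4) + 3t/2`, and `δ t − 9/4 ≤ 3^t (δ 0 − 9/4)`. -/
theorem soloLie_motion_breeding (δ R : ℕ → ℝ) (t : ℕ)
    (h1 : ∀ ℓ, ℓ < t → δ (ℓ + 1) ≤ δ ℓ - 3 / 2 + R ℓ)
    (h2 : ∀ ℓ, ℓ < t → R ℓ ≤ 2 * δ ℓ - 3) :
    (∑ ℓ ∈ range t, R ℓ ≤ (3 ^ t - 1) * (δ 0 - 9 / 4) + 3 / 2 * t) ∧
      δ t - 9 / 4 ≤ 3 ^ t * (δ 0 - 9 / 4) := by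
  induction t with
  | zero => simp
  | succ n ih =>
    obtain ⟨hs, hd⟩ :=
      ih (fun ℓ hℓ => h1 ℓ (Nat.lt_succ_of_lt hℓ)) (fun ℓ hℓ => h2 ℓ (Nat.lt_succ_of_lt hℓ))
    have h1n := h1 n (Nat.lt_succ_self n)
    have h2n := h2 n (Nat.lt_succ_self n)
    have hP : (0 : ℝ) < 3 ^ n := pow_pos (by norm_num) n
    have key : R n ≤ 2 * (3 ^ n * (δ 0 - 9 / 4)) + 3 / 2 := by linarith
    refine ⟨?_, ?_⟩
    · rw [sum_range_succ]
      push_cast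
      have e : ((3 : ℝ) ^ (n + 1) - 1) * (δ 0 - 9 / 4) + 3 / 2 * ((n : ℝ) + 1)
          = ((3 ^ n - 1) * (δ 0 - 9 / 4) + 3 / 2 * n) + (2 * (3 ^ n * (δ 0 - 9 / 4)) + 3 / 2) := by
        ring
      rw [e]
      linarith
    · have h3 : 3 * (δ n - 9 / 4) ≤ 3 * (3 ^ n * (δ 0 - 9 / 4)) :=
        mul_le_mul_of_nonneg_left hd (by norm_num)
      calc δ (n + 1) - 9 / 4 ≤ 3 * (δ n - 9 / 4) := by linarith
        _ ≤ 3 * (3 ^ n * (δ 0 - 9 / 4)) := h3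
        _ = 3 ^ (n + 1) * (δ 0 - 9 / 4) := by ring

/-- (E1′) ARITHMETIC.  Abelian slicing inside the Cauchy-characteristic group: the slice triple has
total dimension `S ≤ 3a − 2τ` (`τ` = dimension of an abelian connected subgroup of `A`), while the
descent gives `S ≥ 3Σ − 3d + 3 − 3ρ/2` with `ρ = d − 1 − a`.  For a REGULAR annihilator with
`𝔤^λ ⊄ ker λ` one has `A` abelian, `τ = a = ι − 1`, whence `Σ ≤ 3d/2 − ι/6 − 4/3`. -/
theorem soloLie_E1_arith (sig d ι a ρ τ S : ℝ)
    (hS1 : S ≤ 3 * a - 2 * τ) (hS2 : 3 * sig - 3 * d + 3 - 3 / 2 * ρ ≤ S)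
    (hρ : ρ = d - 1 - a) (hτ : τ = a) (ha : a = ι - 1) :
    sig ≤ 3 / 2 * d - ι / 6 - 4 / 3 := by
  subst hρ hτ ha
  linarith

/-- SINGULARITY FORCING ((E2′)).  Same two inequalities with `τ ≥ ind 𝔞 ≥ ι − 2` and
`a ≤ z + 1` (`z = dim 𝔤^λ`): the deficit `δ = 3d/2 − Σ` satisfies `δ ≥ ι/6 − (z − ι)/2 − 1/3`;
so `δ < ι/6 − s/2 − 1/3` forces `dim 𝔤^λ ≥ ι + s + 1` at every generic base point. -/
theorem soloLie_singularity_forcing (sig d ι a ρ τ z S δ : ℝ)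
    (hS1 : S ≤ 3 * a - 2 * τ) (hS2 : 3 * sig - 3 * d + 3 - 3 / 2 * ρ ≤ S)
    (hρ : ρ = d - 1 - a) (hτ : ι - 2 ≤ τ) (ha : a ≤ z + 1) (hδ : δ = 3 / 2 * d - sig) :
    ι / 6 - (z - ι) / 2 - 1 / 3 ≤ δ := by
  subst hρ hδ
  linarith

/-- `(3n² − n)/2 − 1 = 3N + n − 1` with `N = n(n−1)/2`: the motionless bound `(3d − ι)/2 − 1` for
`GL_n(ℝ)` (`d = n²`, `ι = n`) is exactly Theorem 1's count — `F(GL_n(ℝ)) = 3N + n − 1`. -/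
theorem soloLie_thm1_value (n : ℝ) :
    (3 * n ^ 2 - n) / 2 - 1 = 3 * (n * (n - 1) / 2) + n - 1 := by
  ring

/-- The exponent certified by a TPP subgroup triple of `GL_n(ℝ)` at the extremal value
`Σ = 3N + n − 1` (BCGPU22 Def. 4.1: `ω ≤ r / (Σ/3 − (d − r)/2)` with `d = n²`, `r = n`) is
`3n/(n − 1)`: the subgroup Lie exponent of `GL_n(ℝ)`. -/
theorem soloLie_subgroup_exponent_GL (n : ℝ) (hn : n ≠ 1) :
    n / ((3 * (n * (n - 1) / 2) + n - 1) / 3 - (n ^ 2 - n) / 2) = 3 * n / (n - 1) := by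
  have h1 : n - 1 ≠ 0 := sub_ne_zero.mpr hn
  rw [show (3 * (n * (n - 1) / 2) + n - 1) / 3 - (n ^ 2 - n) / 2 = (n - 1) / 3 by ring]
  field_simp

end Summit.MatrixMultiplication.MatrixMultiplication.Theorems
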